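import Summits.HodgeConjecture.HodgeConjecture.Theses.PadicSemiregularLift

/-!
# `FormalLiftingFromClassLifting` (stmt-HodgeConjecture-13825) · Negative · one-step class lifting

The cheapest kill criterion for crux P1a of route `PadicSemiregularLift`, kernel-checked by the
standing disprover (refuter-cdisprove-stmt-HodgeConjecture-13825-g2-0, cycle 2, 2026-08-16; also in
the crux workfile `Cruxes/FormalLiftingFromClassLifting/Disproof.lean` §6, here self-contained):

* `classLiftsImplyObjectLifts_of_not_oneStepClassLift`: if the INTEGRAL class `[E₁] ∈ K₀(X_k)` is not
  the restriction of a class on `X_2 = 𝒳 ⊗ W/p²`, then hypothesis (⋆) CLASS-LIFTS-IMPLY-OBJECT-LIFTS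
  of the crux holds VACUOUSLY for `E₁`;
* `liftsFormally_of_not_oneStepClassLift`: hence the crux forces `LiftsFormally 𝒳 E₁` on every such
  `E₁` carrying a rational pro-class — an `E₁` that does not lift to `X_2` even as a class;
* `not_formalLiftingFromClassLifting_of_oneStepWitness`: so ONE finite locally free `E₁` on a
  Hodge-torsion-free `𝒳` (`d + 6 < p`, `d ≤ 3 ∨ Ω¹` free) with `[E₁] ⊗ 1` rationally pro-liftable but
  `[E₁] ∉ im(K₀(X_2) → K₀(X_k))` refutes the crux — no (⋆), no semiregularity, no objects — modulo the
  folklore converse "vector bundle ⇒ finite locally free" (Stacks 01C6 (2)), carried as a hypothesis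
  because the tree proves only `IsFiniteLocallyFree.isVectorBundle`.

Paper status (Disproof.lean cycle 2, (E)): the witness cannot exist for `d ≤ 3` (the one-step
obstruction group `π₋₁K(X_2, X_1) ≅ {H²(X_1,𝒪), H³(X_1,Ω¹)}` is killed by the rational Hodge condition
under torsion-free Hodge cohomology); the theorems below are the formal frame in which any future
witness would be checked.
-/

set_option linter.dupNamespace false

namespace Summit.HodgeConjecture.HodgeConjecture.Theorems.FormalLiftingFromClassLifting.Negative

open CategoryTheory AlgebraicGeometry Limits
open Literature.AlgebraicGeometry Literature.AlgebraicGeometry.Motives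
open Literature.AlgebraicGeometry.Motives.WittScheme
open Summit.HodgeConjecture.HodgeConjecture.Theses.PadicSemiregularLift

noncomputable section

variable {p : ℕ} [Fact p.Prime] {k : Type} [Field k] [CharP k p]

/-- `(W_{m+1} → k) ∘ (W_{n+1} → W_{m+1}) = (W_{n+1} → k)`. [folklore] -/
theorem wittQuotToResidue_comp_factor {m n : ℕ} (h : m + 1 ≤ n + 1) :
    (wittQuotToResidue p k m).comp (Ideal.Quotient.factor (Ideal.pow_le_pow_right h)) =
      wittQuotToResidue p k n := by
  refine Ideal.Quotient.ringHom_ext ?_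
  rw [RingHom.comp_assoc, Ideal.Quotient.factor_comp_mk]
  exact (wittQuotToResidue_comp_algebraMap p k m).trans
    (wittQuotToResidue_comp_algebraMap p k n).symm

variable (𝒳 : SchemeOver (WittVector p k))

/-- `X_k ⟶ X_{m+1} ⟶ X_{n+1}` is `X_k ⟶ X_{n+1}`: the closed immersions of the special fibre into the
thickenings are compatible with the transition maps. [folklore] -/
theorem specialFibreToThickening_comp_thickeningMap {m n : ℕ} (h : m + 1 ≤ n + 1) :
    specialFibreToThickening 𝒳 m ≫ thickeningMap 𝒳 h = specialFibreToThickening 𝒳 n := by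
  -- `erw`: `(specialFibre 𝒳).left`, `(thickening 𝒳 m).left` are the pullbacks only definitionally.
  refine pullback.hom_ext ?_ ?_
  · unfold specialFibreToThickening thickeningMap
    erw [Category.assoc, pullback.lift_fst, pullback.lift_fst_assoc, pullback.lift_fst]
    simp
  · unfold specialFibreToThickening thickeningMap
    erw [Category.assoc, pullback.lift_snd, pullback.lift_snd_assoc, pullback.lift_snd]
    erw [Category.assoc, ← Spec.map_comp, ← CommRingCat.ofHom_comp, wittQuotToResidue_comp_factor h]
    rfl

variable {𝒳}

/-- **If `[E₁] ∉ im(K₀(X_2) → K₀(X_k))`, hypothesis (⋆) of the crux holds vacuously** (verbatim the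
(⋆) clause of `FormalLiftingFromClassLifting`): at level `0` the premise of (⋆) is a one-step class
lift; at level `n + 1 ≥ 1` the restriction `F|X_2` of a finite locally free lift `F` of `E₁` already
gives one. [folklore] -/
theorem classLiftsImplyObjectLifts_of_not_oneStepClassLift
    {E₁ : (specialFibre 𝒳).left.Modules} (hE₁ : IsFiniteLocallyFree E₁)
    (h : ¬ ∃ y : KTheory.KZero (thickening 𝒳 2).left,
      KTheory.KZero.map (specialFibreToThickening 𝒳 1) y = KTheory.KZero.of E₁ hE₁) :
    ∀ (n : ℕ) (F : (thickening 𝒳 (n + 1)).left.Modules) (hF : IsFiniteLocallyFree F),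
      Nonempty ((Scheme.Modules.pullback (specialFibreToThickening 𝒳 n)).obj F ≅ E₁) →
      (∃ y : KTheory.KZero (thickening 𝒳 (n + 2)).left,
        KTheory.KZero.map (thickeningMap 𝒳 (Nat.le_succ (n + 1))) y = KTheory.KZero.of F hF) →
      ∃ F' : (thickening 𝒳 (n + 2)).left.Modules, IsFiniteLocallyFree F' ∧
        Nonempty ((Scheme.Modules.pullback (thickeningMap 𝒳 (Nat.le_succ (n + 1)))).obj F' ≅ F) := by
  intro n F hF hi hy
  obtain ⟨i⟩ := hi
  exfalso
  apply h
  cases n with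
  | zero =>
    obtain ⟨y, hy⟩ := hy
    refine ⟨y, ?_⟩
    rw [← specialFibreToThickening_comp_thickeningMap 𝒳 (Nat.le_succ (0 + 1)),
      KTheory.KZero.map_comp_apply, hy, KTheory.KZero.map_of]
    exact KTheory.KZero.of_iso i _ _
  | succ n =>
    refine ⟨KTheory.KZero.map (thickeningMap 𝒳 (show 1 + 1 ≤ n + 1 + 1 by omega))
      (KTheory.KZero.of F hF), ?_⟩
    rw [← KTheory.KZero.map_comp_apply, specialFibreToThickening_comp_thickeningMap,
      KTheory.KZero.map_of]
    exact KTheory.KZero.of_iso i _ _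

/-- A formal lift `(E_n)_n` of `E₁` restricts to a vector-bundle lift of `E₁` on `X_2`
(`LiftsToThickening 𝒳 E₁ 1`). [folklore] -/
theorem liftsToThickening_one_of_liftsFormally {E₁ : (specialFibre 𝒳).left.Modules}
    (hL : LiftsFormally 𝒳 E₁) : LiftsToThickening 𝒳 E₁ 1 := by
  obtain ⟨E, hvb, htr, ⟨j⟩⟩ := hL
  obtain ⟨i⟩ := htr 0
  refine ⟨E 1, hvb 1, ⟨?_ ≪≫ j⟩⟩
  refine eqToIso (congrArg (fun f => (Scheme.Modules.pullback f).obj _)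
      (specialFibreToThickening_comp_thickeningMap 𝒳 (Nat.le_succ (0 + 1))).symm) ≪≫ ?_
  exact ((Scheme.Modules.pullbackComp (specialFibreToThickening 𝒳 0)
      (thickeningMap 𝒳 (Nat.le_succ (0 + 1)))).app _).symm ≪≫
    (Scheme.Modules.pullback (specialFibreToThickening 𝒳 0)).mapIso i

variable [PerfectRing k p]

/-- **The crux forces a formal lift of every `E₁` whose class does not lift one step** (under its
hypotheses, verbatim, and the rational pro-class hypothesis): (⋆) is then vacuous. [folklore] -/
theorem liftsFormally_of_not_oneStepClassLift (hcrux : FormalLiftingFromClassLifting) {d : ℕ}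
    (h₁ : IsSmoothProperModel d 𝒳) (h₂ : Crystalline.IsProjectiveOverRing 𝒳) (h₃ : d + 6 < p)
    (h₄ : ∀ (b : ℕ) (x : structureSheafCohomology 𝒳.left b), (p : ℤ) • x = 0 → x = 0)
    (h₅ : ∀ (b : ℕ) (x : hodgeCohomologyOne 𝒳 b), (p : ℤ) • x = 0 → x = 0)
    (h₆ : d ≤ 3 ∨ Nonempty (cotangentSheaf 𝒳 ≅ SheafOfModules.free (R := 𝒳.left.ringCatSheaf) (Fin d)))
    {E₁ : (specialFibre 𝒳).left.Modules} (hE₁ : IsFiniteLocallyFree E₁)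
    (hr : ∃ ξ : KTheory.ContinuousKZeroRat (Ideal.span {(p : WittVector p k)}) 𝒳,
      KTheory.KZeroRat.map (Crystalline.specialFibreToTower 𝒳)
        (KTheory.ContinuousKZeroRat.specialFibre (Ideal.span {(p : WittVector p k)}) 𝒳 ξ) =
        KTheory.KZeroRat.of E₁ hE₁)
    (h : ¬ ∃ y : KTheory.KZero (thickening 𝒳 2).left,
      KTheory.KZero.map (specialFibreToThickening 𝒳 1) y = KTheory.KZero.of E₁ hE₁) :
    LiftsFormally 𝒳 E₁ :=
  hcrux p k d 𝒳 h₁ h₂ h₃ h₄ h₅ h₆ E₁ hE₁ (classLiftsImplyObjectLifts_of_not_oneStepClassLift hE₁ h) hr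

omit [PerfectRing k p] in
/-- Modulo the folklore converse "vector bundle ⇒ finite locally free", a formal lift gives a one-step
class lift. [folklore] -/
theorem oneStepClassLift_of_liftsFormally
    (hconv : ∀ (X : Scheme.{0}) (E : X.Modules), IsVectorBundle E → IsFiniteLocallyFree E)
    {E₁ : (specialFibre 𝒳).left.Modules} (hE₁ : IsFiniteLocallyFree E₁) (hL : LiftsFormally 𝒳 E₁) :
    ∃ y : KTheory.KZero (thickening 𝒳 2).left,
      KTheory.KZero.map (specialFibreToThickening 𝒳 1) y = KTheory.KZero.of E₁ hE₁ := by
  obtain ⟨E, hE, ⟨i⟩⟩ := liftsToThickening_one_of_liftsFormally hL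
  refine ⟨KTheory.KZero.of E (hconv _ E hE), ?_⟩
  rw [KTheory.KZero.map_of]
  exact KTheory.KZero.of_iso i _ _

/-- **ONE-STEP CLASS LIFTING IS NECESSARY FOR THE CRUX** (modulo the folklore converse): under the
hypotheses of `FormalLiftingFromClassLifting`, every finite locally free `E₁` with a rational pro-lift of
its class has `[E₁] ∈ im(K₀(𝒳 ⊗ W/p²) → K₀(X_k))`. [folklore] -/
theorem oneStepClassLift_of_formalLiftingFromClassLifting
    (hconv : ∀ (X : Scheme.{0}) (E : X.Modules), IsVectorBundle E → IsFiniteLocallyFree E)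
    (hcrux : FormalLiftingFromClassLifting) {d : ℕ}
    (h₁ : IsSmoothProperModel d 𝒳) (h₂ : Crystalline.IsProjectiveOverRing 𝒳) (h₃ : d + 6 < p)
    (h₄ : ∀ (b : ℕ) (x : structureSheafCohomology 𝒳.left b), (p : ℤ) • x = 0 → x = 0)
    (h₅ : ∀ (b : ℕ) (x : hodgeCohomologyOne 𝒳 b), (p : ℤ) • x = 0 → x = 0)
    (h₆ : d ≤ 3 ∨ Nonempty (cotangentSheaf 𝒳 ≅ SheafOfModules.free (R := 𝒳.left.ringCatSheaf) (Fin d)))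
    {E₁ : (specialFibre 𝒳).left.Modules} (hE₁ : IsFiniteLocallyFree E₁)
    (hr : ∃ ξ : KTheory.ContinuousKZeroRat (Ideal.span {(p : WittVector p k)}) 𝒳,
      KTheory.KZeroRat.map (Crystalline.specialFibreToTower 𝒳)
        (KTheory.ContinuousKZeroRat.specialFibre (Ideal.span {(p : WittVector p k)}) 𝒳 ξ) =
        KTheory.KZeroRat.of E₁ hE₁) :
    ∃ y : KTheory.KZero (thickening 𝒳 2).left,
      KTheory.KZero.map (specialFibreToThickening 𝒳 1) y = KTheory.KZero.of E₁ hE₁ := by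
  by_contra h
  exact h (oneStepClassLift_of_liftsFormally hconv hE₁
    (liftsFormally_of_not_oneStepClassLift hcrux h₁ h₂ h₃ h₄ h₅ h₆ hE₁ hr h))

omit [PerfectRing k p]

/-- **KILL CRITERION.** A single one-step witness — `(p, k, d, 𝒳)` under the hypotheses of the crux and
a finite locally free `E₁` on `X_k` with a rational pro-lift of `[E₁] ⊗ 1` whose integral class does
not lift to `K₀(𝒳 ⊗ W/p²)` — refutes `FormalLiftingFromClassLifting`, modulo the folklore converse
"vector bundle ⇒ finite locally free". [folklore] -/
theorem not_formalLiftingFromClassLifting_of_oneStepWitness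
    (hconv : ∀ (X : Scheme.{0}) (E : X.Modules), IsVectorBundle E → IsFiniteLocallyFree E)
    (w : ∃ (p : ℕ) (_ : Fact p.Prime) (k : Type) (_ : Field k) (_ : CharP k p) (_ : PerfectRing k p)
      (d : ℕ) (𝒳 : SchemeOver (WittVector p k)),
      IsSmoothProperModel d 𝒳 ∧ Crystalline.IsProjectiveOverRing 𝒳 ∧ d + 6 < p ∧
      (∀ (b : ℕ) (x : structureSheafCohomology 𝒳.left b), (p : ℤ) • x = 0 → x = 0) ∧
      (∀ (b : ℕ) (x : hodgeCohomologyOne 𝒳 b), (p : ℤ) • x = 0 → x = 0) ∧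
      (d ≤ 3 ∨ Nonempty (cotangentSheaf 𝒳 ≅ SheafOfModules.free (R := 𝒳.left.ringCatSheaf) (Fin d))) ∧
      ∃ (E₁ : (specialFibre 𝒳).left.Modules) (hE₁ : IsFiniteLocallyFree E₁),
        (∃ ξ : KTheory.ContinuousKZeroRat (Ideal.span {(p : WittVector p k)}) 𝒳,
          KTheory.KZeroRat.map (Crystalline.specialFibreToTower 𝒳)
            (KTheory.ContinuousKZeroRat.specialFibre (Ideal.span {(p : WittVector p k)}) 𝒳 ξ) =
            KTheory.KZeroRat.of E₁ hE₁) ∧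
        ¬ ∃ y : KTheory.KZero (thickening 𝒳 2).left,
          KTheory.KZero.map (specialFibreToThickening 𝒳 1) y = KTheory.KZero.of E₁ hE₁) :
    ¬ FormalLiftingFromClassLifting := by
  obtain ⟨p, _, k, _, _, _, d, 𝒳, h₁, h₂, h₃, h₄, h₅, h₆, E₁, hE₁, hr, h⟩ := w
  exact fun hcrux =>
    h (oneStepClassLift_of_formalLiftingFromClassLifting hconv hcrux h₁ h₂ h₃ h₄ h₅ h₆ hE₁ hr)

end

end Summit.HodgeConjecture.HodgeConjecture.Theorems.FormalLiftingFromClassLifting.Negative
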